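import Summits.ABC.StewartYu.PrincipalUnitLattice
import Literature.NumberTheory.DiophantineGeometry.MultiplicativeGroupApproximationProofs
import HarnessLib

/-!
# The signed principal-unit lattice: valuations and the bridge to `ord_p`

Cell topic `Summits/ABC/StewartYu` (cell abc-stewartyu, HOME `run/shared/lean/pub/abc-stewartyu/`, seat p1); namespace
`Summit.ABC.StewartYu.PrincipalLattice` (continuation of
`Summits/ABC/StewartYu/PrincipalUnitLattice.lean`; theorems only).

Let `p` be a prime, `q₁, …, q_m` DISTINCT primes `≠ p`, `Λ^± ≤ ℤ^m` the signed principal-unit lattice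
and `α̃(z) = χ(z) ∏ qᵢ^{zᵢ}` the sign-normalised generator of `z ∈ Λ^±`. This file proves:

* valuations: `ord_{qᵢ}(∏ q_k^{z_k}) = zᵢ` (`padicValRat_prod_zpow`), so `∏ qᵢ^{zᵢ} = 1 ⇒ z = 0`;
* the bridge to `p`-adic valuations: `ord_p(α̃(z) − 1) ≥ 1` for `z ∈ Λ^± ∖ {0}`
  (`one_le_padicValRat_signedProd_sub_one`), and conversely `ord_p(∏ qᵢ^{eᵢ} − 1) ≥ 1 ⇒ e ∈ ker ψ ≤ Λ^±`
  (`expHom_eq_zero_of_one_le_padicValRat`, `mem_latPM_of_one_le_padicValRat`);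

(The basis lemmas — independence, Kummer condition, the main identity — and the heights are in
`Summits/ABC/StewartYu/PrincipalUnitLatticeKummer.lean`.)

These are the algebraic steps (M1)–(M3), (M6) of work package WP-M of the kernel `p`-adic Baker bound
(cell abc-stewartyu); the Kummer condition is exactly the hypothesis `hind` consumed by the
Cijsouw–Waldschmidt 2-descent (`Literature/NumberTheory/Transcendental/CijsouwWaldschmidt1977Steps.lean`).
All statements are elementary and [folklore].
-/

noncomputable section

open Finset
open Literature.NumberTheory.DiophantineGeometry

namespace Summit.ABC.StewartYu.PrincipalLattice

variable {m : ℕ} {p : ℕ} [hp : Fact p.Prime]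

/-! ### The rational numbers `∏ qᵢ^{zᵢ}`: valuations, positivity -/

/-- `ord_ℓ` of a finite product of non-zero rationals is the sum of the `ord_ℓ`. [folklore] -/
theorem padicValRat_finset_prod {ℓ : ℕ} [Fact ℓ.Prime] {ι : Type*} (s : Finset ι) (f : ι → ℚ)
    (hf : ∀ i ∈ s, f i ≠ 0) : padicValRat ℓ (∏ i ∈ s, f i) = ∑ i ∈ s, padicValRat ℓ (f i) := by
  classical
  induction s using Finset.induction_on with
  | empty => simp
  | insert a s ha ih =>
    rw [Finset.prod_insert ha, Finset.sum_insert ha,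
      padicValRat.mul (hf a (Finset.mem_insert_self a s))
        (Finset.prod_ne_zero_iff.mpr fun i hi => hf i (Finset.mem_insert_of_mem hi)),
      ih fun i hi => hf i (Finset.mem_insert_of_mem hi)]

/-- `ord_{qᵢ}(∏ q_k^{z_k}) = zᵢ` for distinct primes `q_k`. [folklore] -/
theorem padicValRat_prod_zpow (q : Fin m → ℕ) (hq : ∀ i, (q i).Prime)
    (hinj : Function.Injective q) (z : Fin m → ℤ) (i : Fin m) :
    padicValRat (q i) (∏ k, (q k : ℚ) ^ z k) = z i := by
  haveI : Fact (q i).Prime := ⟨hq i⟩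
  have hq0 : ∀ k, (q k : ℚ) ≠ 0 := fun k => by exact_mod_cast (hq k).ne_zero
  rw [padicValRat_finset_prod _ _ fun k _ => zpow_ne_zero _ (hq0 k), Finset.sum_eq_single i]
  · rw [padicValRat.zpow, padicValRat.self (hq i).one_lt, mul_one]
  · intro k _ hki
    haveI : Fact (q k).Prime := ⟨hq k⟩
    rw [padicValRat.zpow, padicValRat.of_nat,
      padicValNat_primes (fun h => hki (hinj h).symm)]
    simp
  · intro h; exact absurd (Finset.mem_univ i) h

/-- `∏ qᵢ^{zᵢ} > 0`. [folklore] -/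
theorem prod_zpow_pos (q : Fin m → ℕ) (hq : ∀ i, (q i).Prime) (z : Fin m → ℤ) :
    0 < ∏ k, (q k : ℚ) ^ z k :=
  Finset.prod_pos fun k _ => zpow_pos (by exact_mod_cast (hq k).pos) _

/-- `∏ qᵢ^{zᵢ} = 1` only for `z = 0` (unique factorisation). [folklore] -/
theorem eq_zero_of_prod_zpow_eq_one (q : Fin m → ℕ) (hq : ∀ i, (q i).Prime)
    (hinj : Function.Injective q) {z : Fin m → ℤ} (h : ∏ k, (q k : ℚ) ^ z k = 1) : z = 0 := by
  funext i
  have := padicValRat_prod_zpow q hq hinj z i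
  rw [h, padicValRat.one] at this
  exact_mod_cast this.symm

/-- In a division ring, `s^c = s^{|c|}` for a sign `s = ±1`. [folklore] -/
theorem sign_zpow_eq_pow_natAbs {K : Type*} [DivisionRing K] {s : K} (hs : s = 1 ∨ s = -1)
    (c : ℤ) : s ^ c = s ^ c.natAbs := by
  rcases hs with rfl | rfl
  · simp
  · rcases Int.natAbs_eq c with h | h
    · conv_lhs => rw [h]
      exact zpow_natCast _ _
    · conv_lhs => rw [h]
      rw [zpow_neg, zpow_natCast, inv_eq_iff_eq_inv]
      rcases neg_one_pow_eq_or K c.natAbs with h1 | h1 <;> rw [h1] <;> norm_num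

/-- `p` divides no product of powers of primes `qᵢ ≠ p`. [folklore] -/
theorem not_dvd_prod_pow (q : Fin m → ℕ) (hq : ∀ i, (q i).Prime) (hqp : ∀ i, q i ≠ p)
    (f : Fin m → ℕ) : ¬ p ∣ ∏ i, q i ^ f i := by
  intro h
  have hp' : _root_.Prime p := Nat.prime_iff.mp hp.out
  obtain ⟨i, -, hi⟩ := (hp'.dvd_finsetProd_iff _).mp h
  have h1 : p ∣ q i := hp.out.dvd_of_dvd_pow hi
  exact hqp i ((Nat.prime_dvd_prime_iff_eq hp.out (hq i)).mp h1).symm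

/-- `∏ qᵢ^{zᵢ} = U/V` with `U = ∏ qᵢ^{zᵢ⁺}`, `V = ∏ qᵢ^{zᵢ⁻}`. [folklore] -/
theorem prod_zpow_eq_div' (q : Fin m → ℕ) (hq : ∀ i, (q i).Prime) (z : Fin m → ℤ) :
    ∏ i, ((q i : ℚ)) ^ z i =
      ((∏ i, q i ^ (z i).toNat : ℕ) : ℚ) / ((∏ i, q i ^ (-z i).toNat : ℕ) : ℚ) := by
  push_cast
  rw [← Finset.prod_div_distrib]
  refine Finset.prod_congr rfl fun i _ => ?_
  have hqi : (q i : ℚ) ≠ 0 := by exact_mod_cast (hq i).ne_zero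
  rw [← zpow_natCast, ← zpow_natCast, ← zpow_sub₀ hqi]
  congr 1
  exact (Int.toNat_sub_toNat_neg (z i)).symm

/-- `ord_p(s·U/V − 1) = ord_p(sU − V)` for an integer `s`, naturals `U, V` with `p ∤ V`,
`sU ≠ V`. [folklore] -/
theorem padicValRat_sign_mul_div_sub_one {U V : ℕ} (hV0 : V ≠ 0) (hpV : ¬ p ∣ V) (s : ℤ)
    (hne : s * U - V ≠ 0) :
    padicValRat p ((s : ℚ) * ((U : ℚ) / V) - 1) = padicValInt p (s * U - V) := by
  have hVQ : (V : ℚ) ≠ 0 := by exact_mod_cast hV0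
  have h1 : (s : ℚ) * ((U : ℚ) / V) - 1 = (((s * U - V : ℤ)) : ℚ) / (V : ℚ) := by
    push_cast; field_simp
  rw [h1, padicValRat.div (by exact_mod_cast hne) hVQ, padicValRat.of_int, padicValRat.of_nat,
    padicValNat.eq_zero_of_not_dvd hpV]
  simp

/-- **Principal units from `Λ^±`.** For `z ∈ Λ^±`, `z ≠ 0`, and primes `qᵢ ≠ p` (distinct):
`ord_p(α̃(z) − 1) ≥ 1`, i.e. `α̃(z) ≡ 1 (mod p)` (write `α̃(z) = χ U/V`; in `ℤ/p`,
`χ Ū = (∏ q̄ᵢ^{zᵢ})² V̄ = V̄`, and `χU ≠ V` as `z ≠ 0`). [folklore] -/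
theorem one_le_padicValRat_signedProd_sub_one (q : Fin m → ℕ) (hq : ∀ i, (q i).Prime)
    (hinj : Function.Injective q) (hqp : ∀ i, q i ≠ p) (hq0 : ∀ i, ((q i : ℕ) : ZMod p) ≠ 0)
    {z : Fin m → ℤ} (hz : z ∈ latPM q hq0) (hz0 : z ≠ 0) :
    1 ≤ padicValRat p (signedProd q hq0 z - 1) := by
  set U : ℕ := ∏ i, q i ^ (z i).toNat with hU
  set V : ℕ := ∏ i, q i ^ (-z i).toNat with hV
  have hU0 : U ≠ 0 := Finset.prod_ne_zero_iff.mpr fun i _ => pow_ne_zero _ (hq i).ne_zero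
  have hV0 : V ≠ 0 := Finset.prod_ne_zero_iff.mpr fun i _ => pow_ne_zero _ (hq i).ne_zero
  have hpV : ¬ p ∣ V := not_dvd_prod_pow q hq hqp _
  have hprod : ∏ i, (q i : ℚ) ^ z i = (U : ℚ) / V := prod_zpow_eq_div' q hq z
  set s : ℤ := unitSign q hq0 z with hs
  -- `s U ≠ V`
  have hne : s * U - V ≠ 0 := by
    intro h
    rcases unitSign_eq_or q hq0 z with h1 | h1
    · rw [← hs] at h1
      rw [h1, one_mul, sub_eq_zero] at h
      have hUV : (U : ℚ) = V := by exact_mod_cast h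
      apply hz0
      apply eq_zero_of_prod_zpow_eq_one q hq hinj
      rw [hprod, hUV, div_self (by exact_mod_cast hV0)]
    · rw [← hs] at h1
      rw [h1] at h
      have : (0 : ℤ) < U + V := by positivity
      omega
  -- the congruence `s U ≡ V (mod p)`
  have hcong : ((s * U - V : ℤ) : ZMod p) = 0 := by
    have hsq := val_toMul_expHom_sq q hq0 hz
    have hden := val_toMul_expHom_mul_den q hq0 z
    have hsgn := cast_unitSign_eq q hq0 hz
    rw [← hs] at hsgn
    push_cast
    rw [hsgn, ← hden, ← mul_assoc, ← sq, hsq, one_mul, sub_self]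
  have hdvd : (p : ℤ) ∣ s * U - V := (ZMod.intCast_zmod_eq_zero_iff_dvd _ p).mp hcong
  -- the valuation
  have hval : padicValRat p (signedProd q hq0 z - 1) = padicValInt p (s * U - V) := by
    unfold signedProd
    rw [hprod, ← hs]
    exact padicValRat_sign_mul_div_sub_one hV0 hpV s hne
  rw [hval]
  rcases (padicValInt_dvd_iff 1 (s * U - V)).mp (by rwa [pow_one]) with h | h
  · exact absurd h hne
  · exact_mod_cast h

/-- If `ord_p(∏ qᵢ^{eᵢ} − 1) ≥ 1` then `∏ q̄ᵢ^{eᵢ} = 1` in `(ℤ/p)ˣ`: `e` lies in the kernel of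
the exponent map, in particular in `Λ^±`. [folklore] -/
theorem expHom_eq_zero_of_one_le_padicValRat (q : Fin m → ℕ) (hq : ∀ i, (q i).Prime)
    (hqp : ∀ i, q i ≠ p) (hq0 : ∀ i, ((q i : ℕ) : ZMod p) ≠ 0) {e : Fin m → ℤ}
    (he : 1 ≤ padicValRat p (∏ i, (q i : ℚ) ^ e i - 1)) : expHom q hq0 e = 0 := by
  set U : ℕ := ∏ i, q i ^ (e i).toNat with hU
  set V : ℕ := ∏ i, q i ^ (-e i).toNat with hV
  have hV0 : V ≠ 0 := Finset.prod_ne_zero_iff.mpr fun i _ => pow_ne_zero _ (hq i).ne_zero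
  have hpV : ¬ p ∣ V := not_dvd_prod_pow q hq hqp _
  have hprod : ∏ i, (q i : ℚ) ^ e i = (U : ℚ) / V := prod_zpow_eq_div' q hq e
  have hne : (1 : ℤ) * U - V ≠ 0 := by
    intro h
    rw [one_mul, sub_eq_zero] at h
    have hUV : (U : ℚ) = V := by exact_mod_cast h
    rw [hprod, hUV, div_self (by exact_mod_cast hV0), sub_self, padicValRat.zero] at he
    exact absurd he (by norm_num)
  have hval : padicValRat p (∏ i, (q i : ℚ) ^ e i - 1) = padicValInt p (1 * U - V) := by
    rw [hprod, ← padicValRat_sign_mul_div_sub_one hV0 hpV 1 hne]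
    push_cast; rw [one_mul]
  rw [hval] at he
  have hdvd : (p : ℤ) ^ 1 ∣ 1 * U - V :=
    (padicValInt_dvd_iff 1 _).mpr (Or.inr (by exact_mod_cast he))
  rw [pow_one, one_mul] at hdvd
  have hUV : (U : ZMod p) = (V : ZMod p) := by
    have := (ZMod.intCast_eq_intCast_iff_dvd_sub (V : ℤ) (U : ℤ) p).mpr hdvd
    push_cast at this
    exact this.symm
  have hden := val_toMul_expHom_mul_den q hq0 e
  rw [← hU, ← hV, hUV] at hden
  have hVne : (V : ZMod p) ≠ 0 := fun h => hpV ((ZMod.natCast_eq_zero_iff V p).mp h)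
  have h1 : ((Additive.toMul (expHom q hq0 e) : (ZMod p)ˣ) : ZMod p) = 1 :=
    mul_right_cancel₀ hVne (by rw [hden, one_mul])
  have h2 : Additive.toMul (expHom q hq0 e) = 1 := Units.val_eq_one.mp h1
  exact toMul_eq_one.mp h2

/-- The hypothesis `ord_p(∏ qᵢ^{eᵢ} − 1) ≥ 1` puts `e` in `Λ^±`. [folklore] -/
theorem mem_latPM_of_one_le_padicValRat (q : Fin m → ℕ) (hq : ∀ i, (q i).Prime)
    (hqp : ∀ i, q i ≠ p) (hq0 : ∀ i, ((q i : ℕ) : ZMod p) ≠ 0) {e : Fin m → ℤ}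
    (he : 1 ≤ padicValRat p (∏ i, (q i : ℚ) ^ e i - 1)) : e ∈ latPM q hq0 :=
  ker_le_latPM q hq0 ((AddMonoidHom.mem_ker).mpr
    (expHom_eq_zero_of_one_le_padicValRat q hq hqp hq0 he))


end Summit.ABC.StewartYu.PrincipalLattice

end
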